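import Summits.Ventures.QEC.Census.CertCheck
import HarnessLib

/-!
# Distance certificate DATA for the HB code `HB40` (CERT-FORMAT v1 → `DistCert`), emitted by qec-search-7

Source certificate: `cert/search-4/j261456/HB_h0-1_n2_c5_chi3.certA.json` — kernel A, id (sha256) `db5cfb0c6d1a344e5a22277952901d14cd499a0bc79318345eedc832382f3014`
(`certA=db5cfb0c6d1a344e` on HOME/STATUS.md), lower-bound methods bruteforce (Z) / bruteforce (X), `found` allow-lists of
sizes 20 (Z) / 20 (X). Code: n = 40, 20 X-checks, 20 Z-checks;
construction "explicit".
Claimed result (by the certificate; established ONLY by the checker theorems in the sibling files):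
n = 40, k = 2, dZ = 6, dX = 6, d = 6. Printed parameters [[40,2,6]] are a CLAIM of
Kovalev–Pryadko, PRA 88, 012311 (2013) = arXiv:1212.6703, §IV.G Ex. 7 (hyperbicycle / rotated-toric family [[2n²c, 2, nχ]] with h = 1+x, n = 2, c = 5, χ = 3; distance obtained «numerically» in print — lit-3 Q2-TARGETS.tsv row HB40, tex chunk p0016 L18-24) — never an input.

Conventions (= `Summits/Ventures/QEC/Census/CertCheck.lean`): a row / operator support is the binary numeral with bit `j` set iff
qubit `j` is in the support; side `Z` = Z-type operators (syndromes by `HX`, stabilizers `HZ`), side `X` the roles exchanged;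
`found` = (word, indices of stabilizer rows XOR-ing to it). This file is DATA: no theorem, no `decide`. Generated
2026-08-27T01:26Z by `HOME/census/search-7/emit_lean.py` (rerun recipe in its README); do not edit by hand — re-emit.
-/

namespace Summit.Ventures.QEC.Census.HB40


/-- The distance certificate of `HB40` as a `DistCert` literal (CERT-FORMAT v1 kernel fields; certificate id
`db5cfb0c6d1a344e`): `n = 40`, `HX`/`HZ` = the 20 + 20 check rows as bitmasks, side Z = (d := 6, weight-6 Z-logical
witness, its non-membership witness, allow-list), side X likewise (d := 6). -/
def cert : DistCert where
  n := 40
  HX := [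
    68720525825, 137441050627, 274882101254, 549764202508, 1090519064, 2181038128,
    4362076256, 8724152512, 17448305024, 34896610048, 1075315712, 2149583872,
    4299167744, 8598335488, 17196670976, 34393341952, 68786683904, 137573367808,
    275146735616, 550293471232]
  HZ := [
    3146753, 6293506, 12587012, 25174024, 50348048, 100696096,
    201392192, 402784384, 805568768, 538444288, 3221226512, 6442453024,
    12884906048, 25769812096, 51539624192, 103079248384, 206158495745, 412316991490,
    824633982980, 550830080008]
  sideZ := { d := 6, witness := 1074790415, nonmember := 3181088,
             found := [
      (3146753, [0]), (206158495745, [16]),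
      (6293506, [1]), (412316991490, [17]),
      (12587012, [2]), (824633982980, [18]),
      (25174024, [3]), (550830080008, [0, 1, 2, 3, 4, 5, 6, 7, 8, 9, 10, 11, 12, 13, 14, 15, 16, 17, 18]),
      (3221226512, [10]), (50348048, [4]),
      (6442453024, [11]), (100696096, [5]),
      (12884906048, [12]), (201392192, [6]),
      (25769812096, [13]), (402784384, [7]),
      (51539624192, [14]), (805568768, [8]),
      (103079248384, [15]), (538444288, [9])] }
  sideX := { d := 6, witness := 3181088, nonmember := 1074790415,
             found := [
      (137441050627, [1]), (68720525825, [0]),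
      (274882101254, [2]), (549764202508, [3]),
      (1090519064, [4]), (2181038128, [5]),
      (4362076256, [6]), (8724152512, [7]),
      (17448305024, [8]), (34896610048, [9]),
      (2149583872, [11]), (1075315712, [10]),
      (4299167744, [12]), (8598335488, [13]),
      (17196670976, [14]), (34393341952, [15]),
      (68786683904, [16]), (137573367808, [17]),
      (275146735616, [18]), (550293471232, [0, 1, 2, 3, 4, 5, 6, 7, 8, 9, 10, 11, 12, 13, 14, 15, 16, 17, 18])] }

end Summit.Ventures.QEC.Census.HB40
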